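import Summits.AnomalousDissipation.AnomalousDissipation.Theorems.MomentParityQuarticGateAxialQuadForms
import Summits.AnomalousDissipation.AnomalousDissipation.Theorems.MomentParityQuarticGateAxialQuadPolar
import Summits.AnomalousDissipation.AnomalousDissipation.Theorems.MomentParityQuarticGateModeCalculus

/-!
# Axial quadratic rigidity (stub S2q of line `axis-sectors`, crux `MomentParity.QuarticGate`):
# the polarised triad identity `(POL)` from the Casimir clause

For band tests `g` and a homogeneous quadratic `P` whose observable `p = P((·, g))` is a Casimir of
level-`N` Galerkin–Euler, the HESSIAN BLOCKS
`Q a b = Σᵢⱼ hᵢⱼ ĝᵢ(-a) ĝⱼ(-b)ᵀ` (`hᵢⱼ = coeff 0 (∂ⱼ∂ᵢP)`, `ĝ = tcoef g`) satisfy the polarised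
single-triad identity `(POL)` of the algebraic core (`…AxialQuadCore`):

1. the Casimir clause in coefficients (`casimir_iff_coef` of the dictionary) is, for every
   conjugate-symmetric admissible family `c`, the vanishing of the diagonal `Γ(c,c,c)` of an explicit
   complex-trilinear form `Γ` (`…AxialQuadForms` converts the real sums);
2. polarisation + complexification (`…AxialQuadPolar`) gives the vanishing of the symmetrisation of
   `Γ` on one-sided probes `δ_{k} v`;
3. on probes `Γ(δ_{k₁}v₁, δ_{k₂}v₂, δ_{k₃}v₃) = -2πi (v₁·k₃) v₃ᵀ Q_{k₁+k₃,k₂} v₂`, and the six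
   permutations assemble to `(POL)`.
-/

namespace Summit.AnomalousDissipation.AnomalousDissipation.Theorems.MomentParityQuarticGate.AxialQuad

open scoped InnerProductSpace ComplexConjugate
open Matrix
open Literature.Analysis.FunctionSpaces Literature.Analysis.FluidPDE
open Summit.AnomalousDissipation.AnomalousDissipation.Theorems.QuarticGate.Negative

-- `Summit.<Summit>.<Problem>` is the tree's mandated summit-side namespace (CONVENTIONS §2); for this
-- single-conjunct summit the two coincide, so the duplicate is deliberate.
set_option linter.dupNamespace false

noncomputable section

/-! ## Tools -/

section Tools

/-- The punctured ball in integer form. [folklore] -/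
theorem mem_ball_iff {N : ℕ} (k : Fin 3 → ℤ) :
    k ∈ (Torus.freqBall N).erase 0 ↔ (k ≠ 0 ∧ k ⬝ᵥ k ≤ ((N : ℕ) : ℤ) ^ 2) := by
  rw [Finset.mem_erase, Torus.mem_freqBall]
  refine and_congr Iff.rfl ?_
  have e : ((k ⬝ᵥ k : ℤ) : ℝ) = Torus.freqNormSq k := by
    simp [Torus.freqNormSq, vec3_dotProduct, Fin.sum_univ_three, sq]
  rw [← Int.cast_le (R := ℝ), Int.cast_pow, Int.cast_natCast, e]

/-- **The convection symbol of a single advecting mode**: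
`convectionCoeff S (δ_l u) c' κ = [κ - l ∈ S] (2πi (u · (κ - l))) • c' (κ - l)` for `l ∈ S`. [folklore] -/
theorem convectionCoeff_single_left {S : Finset (Fin 3 → ℤ)} {l : Fin 3 → ℤ} (hl : l ∈ S)
    (u : EuclideanSpace ℂ (Fin 3)) (c' : (Fin 3 → ℤ) → EuclideanSpace ℂ (Fin 3)) (κ : Fin 3 → ℤ) :
    Torus.convectionCoeff S (Pi.single l u) c' κ =
      if κ - l ∈ S then (2 * Real.pi * Complex.I * ∑ j, u j * ((κ - l) j : ℂ)) • c' (κ - l) else 0 := by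
  rw [Torus.convectionCoeff_def, Finset.sum_eq_single l (fun l' _ hl' => Finset.sum_eq_zero fun m' _ => by
      simp [Pi.single_eq_of_ne hl']) (fun h => (h hl).elim)]
  simp only [Pi.single_eq_same]
  have : ∀ m' : Fin 3 → ℤ, (l + m' = κ) ↔ (κ - l = m') := fun m' => by
    constructor <;> intro h <;> [rw [← h]; rw [h.symm]] <;> abel
  simp_rw [this]
  rw [Finset.sum_ite_eq]

/-- **The Hessian blocks against two vectors**:
`v · (Σᵢⱼ hᵢⱼ Xᵢ Yⱼᵀ) w = Σᵢⱼ hᵢⱼ (v·Xᵢ)(Yⱼ·w)`. [folklore] -/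
theorem dotProduct_hessianBlock_mulVec {m : ℕ} (hC : Fin m → Fin m → ℂ) (X Y : Fin m → Fin 3 → ℂ)
    (v w : Fin 3 → ℂ) :
    v ⬝ᵥ ((∑ i, ∑ j, hC i j • Matrix.vecMulVec (X i) (Y j)) *ᵥ w) =
      ∑ i, ∑ j, hC i j * (v ⬝ᵥ X i) * (Y j ⬝ᵥ w) := by
  simp only [Matrix.sum_mulVec, Matrix.smul_mulVec, dotProduct_sum, dotProduct_smul, Matrix.dotProduct_mulVec,
    Matrix.vecMul_vecMulVec, smul_dotProduct, smul_eq_mul]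
  exact Finset.sum_congr rfl fun i _ => Finset.sum_congr rfl fun j _ => by ring

end Tools

/-! ## The trilinear form `Γ` -/

section Gamma

variable {m : ℕ} (S S' : Finset (Fin 3 → ℤ)) (G : Fin m → (Fin 3 → ℤ) → EuclideanSpace ℂ (Fin 3))
  (hC : Fin m → Fin m → ℂ)

/-- `Γ` is additive in the advecting slot. [folklore] -/
theorem gamma_add₁ (x x' y z : (Fin 3 → ℤ) → EuclideanSpace ℂ (Fin 3)) :
    (∑ i, ∑ j, hC i j * (∑ k ∈ S', WithLp.ofLp ((y) k) ⬝ᵥ WithLp.ofLp (G j (-k))) * (∑ k ∈ S, WithLp.ofLp (Torus.convectionCoeff S (x + x') (G i) (-k)) ⬝ᵥ WithLp.ofLp ((z) k))) = (∑ i, ∑ j, hC i j * (∑ k ∈ S', WithLp.ofLp ((y) k) ⬝ᵥ WithLp.ofLp (G j (-k))) * (∑ k ∈ S, WithLp.ofLp (Torus.convectionCoeff S (x) (G i) (-k)) ⬝ᵥ WithLp.ofLp ((z) k))) + (∑ i, ∑ j, hC i j * (∑ k ∈ S', WithLp.ofLp ((y) k) ⬝ᵥ WithLp.ofLp (G j (-k)))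 * (∑ k ∈ S, WithLp.ofLp (Torus.convectionCoeff S (x') (G i) (-k)) ⬝ᵥ WithLp.ofLp ((z) k))) := by
  simp only [Torus.convectionCoeff_add_left, WithLp.ofLp_add, add_dotProduct, Finset.sum_add_distrib, mul_add]

/-- `Γ` is additive in the observable slot. [folklore] -/
theorem gamma_add₂ (x y y' z : (Fin 3 → ℤ) → EuclideanSpace ℂ (Fin 3)) :
    (∑ i, ∑ j, hC i j * (∑ k ∈ S', WithLp.ofLp ((y + y') k) ⬝ᵥ WithLp.ofLp (G j (-k))) * (∑ k ∈ S, WithLp.ofLp (Torus.convectionCoeff S (x) (G i) (-k)) ⬝ᵥ WithLp.ofLp ((z) k))) = (∑ i, ∑ j, hC i j * (∑ k ∈ S', WithLp.ofLp ((y) k) ⬝ᵥ WithLp.ofLp (G j (-k))) * (∑ k ∈ S, WithLp.ofLp (Torus.convectionCoeff S (x) (G i) (-k)) ⬝ᵥ WithLp.ofLp ((z) k))) + (∑ i, ∑ j, hC i j * (∑ k ∈ S', WithLp.ofLp ((y') k) ⬝ᵥ WithLp.ofLp (G j (-k))) * (∑ k ∈ S, WithLp.ofLp (Torus.convectionCoeff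 S (x) (G i) (-k)) ⬝ᵥ WithLp.ofLp ((z) k))) := by
  simp only [Pi.add_apply, WithLp.ofLp_add, add_dotProduct, Finset.sum_add_distrib, mul_add, add_mul]

/-- `Γ` is additive in the paired slot. [folklore] -/
theorem gamma_add₃ (x y z z' : (Fin 3 → ℤ) → EuclideanSpace ℂ (Fin 3)) :
    (∑ i, ∑ j, hC i j * (∑ k ∈ S', WithLp.ofLp ((y) k) ⬝ᵥ WithLp.ofLp (G j (-k))) * (∑ k ∈ S, WithLp.ofLp (Torus.convectionCoeff S (x) (G i) (-k)) ⬝ᵥ WithLp.ofLp ((z + z') k))) = (∑ i, ∑ j, hC i j * (∑ k ∈ S', WithLp.ofLp ((y) k) ⬝ᵥ WithLp.ofLp (G j (-k))) * (∑ k ∈ S, WithLp.ofLp (Torus.convectionCoeff S (x) (G i) (-k)) ⬝ᵥ WithLp.ofLp ((z) k))) + (∑ i, ∑ j, hC i j * (∑ k ∈ S', WithLp.ofLp ((y) k) ⬝ᵥ WithLp.ofLp (G j (-k))) * (∑ k ∈ S, WithLp.ofLp (Torus.convectionCoeff S (x) (G i) (-k)) ⬝ᵥ WithLp.ofLp ((z')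 k))) := by
  simp only [Pi.add_apply, WithLp.ofLp_add, dotProduct_add, Finset.sum_add_distrib, mul_add]

/-- `Γ` is homogeneous in the advecting slot. [folklore] -/
theorem gamma_smul₁ (t : ℂ) (x y z : (Fin 3 → ℤ) → EuclideanSpace ℂ (Fin 3)) :
    (∑ i, ∑ j, hC i j * (∑ k ∈ S', WithLp.ofLp ((y) k) ⬝ᵥ WithLp.ofLp (G j (-k))) * (∑ k ∈ S, WithLp.ofLp (Torus.convectionCoeff S (t • x) (G i) (-k)) ⬝ᵥ WithLp.ofLp ((z) k))) = t * (∑ i, ∑ j, hC i j * (∑ k ∈ S', WithLp.ofLp ((y) k) ⬝ᵥ WithLp.ofLp (G j (-k))) * (∑ k ∈ S, WithLp.ofLp (Torus.convectionCoeff S (x) (G i) (-k)) ⬝ᵥ WithLp.ofLp ((z) k))) := by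
  have h : ∀ i, (∑ k ∈ S, WithLp.ofLp (Torus.convectionCoeff S (t • x) (G i) (-k)) ⬝ᵥ WithLp.ofLp (z k)) =
      t * ∑ k ∈ S, WithLp.ofLp (Torus.convectionCoeff S x (G i) (-k)) ⬝ᵥ WithLp.ofLp (z k) := fun i => by
    rw [Finset.mul_sum]
    exact Finset.sum_congr rfl fun k _ => by
      rw [Torus.convectionCoeff_smul_left, WithLp.ofLp_smul, smul_dotProduct, smul_eq_mul]
  simp_rw [h]
  rw [Finset.mul_sum Finset.univ]
  refine Finset.sum_congr rfl fun i _ => ?_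
  rw [Finset.mul_sum Finset.univ]
  exact Finset.sum_congr rfl fun j _ => by ring

/-- `Γ` is homogeneous in the observable slot. [folklore] -/
theorem gamma_smul₂ (t : ℂ) (x y z : (Fin 3 → ℤ) → EuclideanSpace ℂ (Fin 3)) :
    (∑ i, ∑ j, hC i j * (∑ k ∈ S', WithLp.ofLp ((t • y) k) ⬝ᵥ WithLp.ofLp (G j (-k))) * (∑ k ∈ S, WithLp.ofLp (Torus.convectionCoeff S (x) (G i) (-k)) ⬝ᵥ WithLp.ofLp ((z) k))) = t * (∑ i, ∑ j, hC i j * (∑ k ∈ S', WithLp.ofLp ((y) k) ⬝ᵥ WithLp.ofLp (G j (-k))) * (∑ k ∈ S, WithLp.ofLp (Torus.convectionCoeff S (x) (G i) (-k)) ⬝ᵥ WithLp.ofLp ((z) k))) := by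
  have h : ∀ j, (∑ k ∈ S', WithLp.ofLp ((t • y) k) ⬝ᵥ WithLp.ofLp (G j (-k))) =
      t * ∑ k ∈ S', WithLp.ofLp (y k) ⬝ᵥ WithLp.ofLp (G j (-k)) := fun j => by
    rw [Finset.mul_sum]
    exact Finset.sum_congr rfl fun k _ => by rw [Pi.smul_apply, WithLp.ofLp_smul, smul_dotProduct, smul_eq_mul]
  simp_rw [h]
  rw [Finset.mul_sum Finset.univ]
  refine Finset.sum_congr rfl fun i _ => ?_
  rw [Finset.mul_sum Finset.univ]
  exact Finset.sum_congr rfl fun j _ => by ring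

/-- `Γ` is homogeneous in the paired slot. [folklore] -/
theorem gamma_smul₃ (t : ℂ) (x y z : (Fin 3 → ℤ) → EuclideanSpace ℂ (Fin 3)) :
    (∑ i, ∑ j, hC i j * (∑ k ∈ S', WithLp.ofLp ((y) k) ⬝ᵥ WithLp.ofLp (G j (-k))) * (∑ k ∈ S, WithLp.ofLp (Torus.convectionCoeff S (x) (G i) (-k)) ⬝ᵥ WithLp.ofLp ((t • z) k))) = t * (∑ i, ∑ j, hC i j * (∑ k ∈ S', WithLp.ofLp ((y) k) ⬝ᵥ WithLp.ofLp (G j (-k))) * (∑ k ∈ S, WithLp.ofLp (Torus.convectionCoeff S (x) (G i) (-k)) ⬝ᵥ WithLp.ofLp ((z) k))) := by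
  have h : ∀ i, (∑ k ∈ S, WithLp.ofLp (Torus.convectionCoeff S x (G i) (-k)) ⬝ᵥ WithLp.ofLp ((t • z) k)) =
      t * ∑ k ∈ S, WithLp.ofLp (Torus.convectionCoeff S x (G i) (-k)) ⬝ᵥ WithLp.ofLp (z k) := fun i => by
    rw [Finset.mul_sum]
    exact Finset.sum_congr rfl fun k _ => by rw [Pi.smul_apply, WithLp.ofLp_smul, dotProduct_smul, smul_eq_mul]
  simp_rw [h]
  rw [Finset.mul_sum Finset.univ]
  refine Finset.sum_congr rfl fun i _ => ?_
  rw [Finset.mul_sum Finset.univ]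
  exact Finset.sum_congr rfl fun j _ => by ring

/-- **`Γ` on one-sided probes.** For `S' ⊆ S`, `G` supported in `S'`, `k₁ ∈ S`, `k₂ ∈ S'`, `k₃ ∈ S`
and `v₁ ⊥ k₁`: `Γ(δ_{k₁}v₁, δ_{k₂}v₂, δ_{k₃}v₃) = 2πi · (-(v₁·k₃)) · v₃ᵀ Q_{k₁+k₃,k₂} v₂` with the
Hessian blocks `Q a b = Σᵢⱼ hᵢⱼ Gᵢ(-a) Gⱼ(-b)ᵀ`. [folklore] -/
theorem gamma_single (hSS : S' ⊆ S) (hG : ∀ i, ∀ k ∉ S', G i k = 0) {k₁ k₂ k₃ : Fin 3 → ℤ}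
    (hk₁ : k₁ ∈ S) (hk₂ : k₂ ∈ S') (hk₃ : k₃ ∈ S) (v₁ v₂ v₃ : Fin 3 → ℂ) (hv₁ : v₁ ⬝ᵥ (fun i : Fin 3 => (((k₁ : Fin 3 → ℤ) i : ℤ) : ℂ)) = 0) :
    (∑ i, ∑ j, hC i j * (∑ k ∈ S', WithLp.ofLp (((Pi.single k₂ (WithLp.toLp 2 v₂) : (Fin 3 → ℤ) → EuclideanSpace ℂ (Fin 3))) k) ⬝ᵥ WithLp.ofLp (G j (-k))) * (∑ k ∈ S, WithLp.ofLp (Torus.convectionCoeff S ((Pi.single k₁ (WithLp.toLp 2 v₁) : (Fin 3 → ℤ) → EuclideanSpace ℂ (Fin 3))) (G i) (-k)) ⬝ᵥ WithLp.ofLp (((Pi.single k₃ (WithLp.toLp 2 v₃) : (Fin 3 → ℤ) → EuclideanSpace ℂ (Fin 3))) k))) =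
      (2 * Real.pi * Complex.I) * (-(v₁ ⬝ᵥ (fun i : Fin 3 => (((k₃ : Fin 3 → ℤ) i : ℤ) : ℂ)))) *
        (v₃ ⬝ᵥ ((∑ i, ∑ j, hC i j • Matrix.vecMulVec (WithLp.ofLp (G i (-(k₁ + k₃))))
          (WithLp.ofLp (G j (-k₂)))) *ᵥ v₂)) := by
  -- the observable slot
  have hπ : ∀ j, (∑ k ∈ S', WithLp.ofLp ((Pi.single k₂ (WithLp.toLp 2 v₂) :
      (Fin 3 → ℤ) → EuclideanSpace ℂ (Fin 3)) k) ⬝ᵥ WithLp.ofLp (G j (-k))) = v₂ ⬝ᵥ WithLp.ofLp (G j (-k₂)) := by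
    intro j
    rw [sum_apply_single hk₂ (fun κ (w : EuclideanSpace ℂ (Fin 3)) => WithLp.ofLp w ⬝ᵥ WithLp.ofLp (G j (-κ)))
      (fun κ => by simp)]
  -- the convection symbol of the probe
  have hB : ∀ i, WithLp.ofLp (Torus.convectionCoeff S (Pi.single k₁ (WithLp.toLp 2 v₁)) (G i) (-k₃)) =
      (2 * Real.pi * Complex.I * (-(v₁ ⬝ᵥ (fun i : Fin 3 => (((k₃ : Fin 3 → ℤ) i : ℤ) : ℂ))))) • WithLp.ofLp (G i (-(k₁ + k₃))) := by
    intro i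
    rw [convectionCoeff_single_left hk₁]
    have e : -k₃ - k₁ = -(k₁ + k₃) := by abel
    have hsum : ∑ j, (WithLp.toLp 2 v₁ : EuclideanSpace ℂ (Fin 3)) j * ((-k₃ - k₁) j : ℂ) = -(v₁ ⬝ᵥ (fun i : Fin 3 => (((k₃ : Fin 3 → ℤ) i : ℤ) : ℂ))) := by
      rw [dotProduct] at hv₁ ⊢
      rw [← neg_eq_zero, ← Finset.sum_neg_distrib] at hv₁
      rw [← add_zero (-(∑ i, v₁ i * ((k₃ i : ℤ) : ℂ))), ← hv₁, ← Finset.sum_neg_distrib, ← Finset.sum_add_distrib]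
      refine Finset.sum_congr rfl fun j _ => ?_
      simp only [Pi.sub_apply, Pi.neg_apply, Int.cast_sub, Int.cast_neg]
      ring
    rw [hsum, e]
    split_ifs with hmem
    · rw [WithLp.ofLp_smul]
    · rw [hG i _ (fun h => hmem (hSS h)), WithLp.ofLp_zero, smul_zero]
  -- the paired slot
  have hβ : ∀ i, (∑ k ∈ S, WithLp.ofLp (Torus.convectionCoeff S (Pi.single k₁ (WithLp.toLp 2 v₁)) (G i) (-k)) ⬝ᵥ
      WithLp.ofLp ((Pi.single k₃ (WithLp.toLp 2 v₃) : (Fin 3 → ℤ) → EuclideanSpace ℂ (Fin 3)) k)) =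
      (2 * Real.pi * Complex.I * (-(v₁ ⬝ᵥ (fun i : Fin 3 => (((k₃ : Fin 3 → ℤ) i : ℤ) : ℂ))))) * (WithLp.ofLp (G i (-(k₁ + k₃))) ⬝ᵥ v₃) := by
    intro i
    rw [sum_apply_single hk₃ (fun κ (w : EuclideanSpace ℂ (Fin 3)) =>
      WithLp.ofLp (Torus.convectionCoeff S (Pi.single k₁ (WithLp.toLp 2 v₁)) (G i) (-κ)) ⬝ᵥ WithLp.ofLp w)
      (fun κ => by simp), hB i, smul_dotProduct, smul_eq_mul]
  simp_rw [hπ, hβ]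
  rw [dotProduct_hessianBlock_mulVec, Finset.mul_sum Finset.univ]
  refine Finset.sum_congr rfl fun i _ => ?_
  rw [Finset.mul_sum Finset.univ]
  refine Finset.sum_congr rfl fun j _ => ?_
  rw [dotProduct_comm v₂, dotProduct_comm _ v₃]
  ring

end Gamma

/-! ## `(POL)` for the Hessian blocks -/

section Main

/-- A one-sided probe `δ_k v` with `v ⊥ k`, `k` in the punctured ball, is a complex combination of two
admissible (conjugate-symmetric, transversal, supported) families. [folklore] -/
theorem probe_decomposition {N : ℕ} {k : Fin 3 → ℤ} (hk : k ∈ (Torus.freqBall N).erase 0)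
    {v : Fin 3 → ℂ} (hv : v ⬝ᵥ (fun i : Fin 3 => (((k : Fin 3 → ℤ) i : ℤ) : ℂ)) = 0) :
    ∃ x' ∈ {c : (Fin 3 → ℤ) → EuclideanSpace ℂ (Fin 3) | Torus.IsConjSymm c ∧
        Torus.IsTransversal ((Torus.freqBall N).erase 0) c ∧ ∀ k ∉ (Torus.freqBall N).erase 0, c k = 0},
      ∃ x'' ∈ {c : (Fin 3 → ℤ) → EuclideanSpace ℂ (Fin 3) | Torus.IsConjSymm c ∧
        Torus.IsTransversal ((Torus.freqBall N).erase 0) c ∧ ∀ k ∉ (Torus.freqBall N).erase 0, c k = 0},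
      (Pi.single k (WithLp.toLp 2 v) : (Fin 3 → ℤ) → EuclideanSpace ℂ (Fin 3)) = x' + Complex.I • x'' :=
  exists_conjSymm_decomposition neg_mem_freqBall_erase_zero
    (isTransversal_single _ (by
      rw [dotProduct] at hv
      rw [← hv]
      exact Finset.sum_congr rfl fun j _ => by rw [show (WithLp.toLp 2 v : EuclideanSpace ℂ (Fin 3)) j = v j from rfl, mul_comm]))
    (single_eq_zero_of_not_mem hk _)

set_option maxHeartbeats 1600000 in
-- one long assembly
/-- **`(POL)` FOR THE HESSIAN BLOCKS OF A QUADRATIC CASIMIR.** For band tests `g` and a homogeneous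
quadratic `P` whose observable is a Casimir of level-`N` Galerkin–Euler, the Hessian blocks
`Q a b = Σᵢⱼ hᵢⱼ ĝᵢ(-a) ĝⱼ(-b)ᵀ` satisfy the polarised single-triad identity. [folklore] -/
theorem pol_of_casimir {N m : ℕ} (g : Fin m → UnitAddTorus (Fin 3) → EuclideanSpace ℝ (Fin 3))
    (hg : ∀ i, IsBandTest N (g i)) (P : MvPolynomial (Fin m) ℝ) (hP : P.IsHomogeneous 2)
    (hCas : ∀ u : Torus.energySpace (Fin 3), IsLevel N u →
      Torus.nsGeneratorPairing (d := Fin 3) 0 0 u (polyGrad g P u) = 0)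
    (k₁ k₂ k₃ : Fin 3 → ℤ) (v₁ v₂ v₃ : Fin 3 → ℂ) (hk₁ : ((k₁ : Fin 3 → ℤ) ≠ 0 ∧ (k₁) ⬝ᵥ (k₁) ≤ ((N : ℕ) : ℤ) ^ 2)) (hk₂ : ((k₂ : Fin 3 → ℤ) ≠ 0 ∧ (k₂) ⬝ᵥ (k₂) ≤ ((N : ℕ) : ℤ) ^ 2)) (hk₃ : ((k₃ : Fin 3 → ℤ) ≠ 0 ∧ (k₃) ⬝ᵥ (k₃) ≤ ((N : ℕ) : ℤ) ^ 2))
    (hv₁ : v₁ ⬝ᵥ (fun i : Fin 3 => (((k₁ : Fin 3 → ℤ) i : ℤ) : ℂ)) = 0) (hv₂ : v₂ ⬝ᵥ (fun i : Fin 3 => (((k₂ : Fin 3 → ℤ) i : ℤ) : ℂ)) = 0) (hv₃ : v₃ ⬝ᵥ (fun i : Fin 3 => (((k₃ : Fin 3 → ℤ) i : ℤ) : ℂ)) = 0) :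
    (((v₁) ⬝ᵥ (fun i : Fin 3 => (((k₂ : Fin 3 → ℤ) i : ℤ) : ℂ))) • (v₂) + ((v₂) ⬝ᵥ (fun i : Fin 3 => (((k₁ : Fin 3 → ℤ) i : ℤ) : ℂ))) • (v₁) : Fin 3 → ℂ) ⬝ᵥ ((∑ i, ∑ j, (((MvPolynomial.pderiv j (MvPolynomial.pderiv i P)).coeff 0 : ℝ) : ℂ) • Matrix.vecMulVec (WithLp.ofLp (tcoef (g i) (-(k₁ + k₂)))) (WithLp.ofLp (tcoef (g j) (-(k₃))))) *ᵥ v₃) + (((v₁) ⬝ᵥ (fun i : Fin 3 => (((k₃ : Fin 3 → ℤ) i : ℤ) : ℂ))) • (v₃) + ((v₃) ⬝ᵥ (fun i : Fin 3 => (((k₁ : Fin 3 → ℤ) i : ℤ) : ℂ))) • (v₁) : Fin 3 → ℂ) ⬝ᵥ ((∑ i, ∑ j, (((MvPolynomial.pderiv j (MvPolynomial.pderiv i P)).coeff 0 : ℝ) : ℂ) • Matrix.vecMulVec (WithLp.ofLp (tcoef (g i) (-(k₁ + k₃)))) (WithLp.ofLp (tcoef (g j) (-(k₂))))) *ᵥ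 v₂) +
      (((v₂) ⬝ᵥ (fun i : Fin 3 => (((k₃ : Fin 3 → ℤ) i : ℤ) : ℂ))) • (v₃) + ((v₃) ⬝ᵥ (fun i : Fin 3 => (((k₂ : Fin 3 → ℤ) i : ℤ) : ℂ))) • (v₂) : Fin 3 → ℂ) ⬝ᵥ ((∑ i, ∑ j, (((MvPolynomial.pderiv j (MvPolynomial.pderiv i P)).coeff 0 : ℝ) : ℂ) • Matrix.vecMulVec (WithLp.ofLp (tcoef (g i) (-(k₂ + k₃)))) (WithLp.ofLp (tcoef (g j) (-(k₁))))) *ᵥ v₁) = 0 := by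
  set S : Finset (Fin 3 → ℤ) := Torus.freqBall N with hSdef
  set S' : Finset (Fin 3 → ℤ) := (Torus.freqBall N).erase 0 with hS'def
  have hS : ∀ k ∈ S, -k ∈ S := Torus.neg_mem_freqBall_of_mem
  have hS' : ∀ k ∈ S', -k ∈ S' := neg_mem_freqBall_erase_zero
  have hSS : S' ⊆ S := Finset.erase_subset _ _
  have hk₁' : k₁ ∈ S' := (mem_ball_iff k₁).2 hk₁
  have hk₂' : k₂ ∈ S' := (mem_ball_iff k₂).2 hk₂
  have hk₃' : k₃ ∈ S' := (mem_ball_iff k₃).2 hk₃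
  have hGcs : ∀ i, Torus.IsConjSymm (tcoef (g i)) := fun i =>
    isConjSymm_tcoef (hg i).1.continuous.integrable_unitAddTorus
  have hGsupp : ∀ i, ∀ k ∉ S', (fun i => tcoef (g i)) i k = 0 := fun i k hk => (hg i).2.2.2 k hk
  -- the additively closed set of admissible families
  have hA : ∀ a ∈ {c : (Fin 3 → ℤ) → EuclideanSpace ℂ (Fin 3) | Torus.IsConjSymm c ∧
      Torus.IsTransversal S' c ∧ ∀ k ∉ S', c k = 0}, ∀ b ∈ {c : (Fin 3 → ℤ) → EuclideanSpace ℂ (Fin 3) |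
      Torus.IsConjSymm c ∧ Torus.IsTransversal S' c ∧ ∀ k ∉ S', c k = 0}, a + b ∈
      {c : (Fin 3 → ℤ) → EuclideanSpace ℂ (Fin 3) | Torus.IsConjSymm c ∧
        Torus.IsTransversal S' c ∧ ∀ k ∉ S', c k = 0} := fun a ha b hb => admissible_add ha hb
  -- Step A: the Casimir clause is the vanishing of the diagonal of `Γ`
  have hF := (casimir_iff_coef g hg P).1 hCas
  have hΓ : ∀ c ∈ {c : (Fin 3 → ℤ) → EuclideanSpace ℂ (Fin 3) | Torus.IsConjSymm c ∧
      Torus.IsTransversal S' c ∧ ∀ k ∉ S', c k = 0},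
      (∑ i, ∑ j, (fun i j => (((MvPolynomial.pderiv j (MvPolynomial.pderiv i P)).coeff 0 : ℝ) : ℂ)) i j * (∑ k ∈ S', WithLp.ofLp ((c) k) ⬝ᵥ WithLp.ofLp ((fun i => tcoef (g i)) j (-k))) * (∑ k ∈ S, WithLp.ofLp (Torus.convectionCoeff S (c) ((fun i => tcoef (g i)) i) (-k)) ⬝ᵥ WithLp.ofLp ((c) k))) = 0 := by
    rintro c ⟨hc, hT, hsupp⟩
    beta_reduce
    have e1 : ∀ j, ∑ k ∈ S', (((inner ℂ (c k) (tcoef (g j) k)).re : ℝ) : ℂ) =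
        ∑ k ∈ S', WithLp.ofLp (c k) ⬝ᵥ WithLp.ofLp (tcoef (g j) (-k)) := fun j => pairingSum_eq' hS' hc (hGcs j)
    have e2 : ∀ i, ∑ k ∈ S, (((inner ℂ (Torus.convectionCoeff S c (tcoef (g i)) k) (c k)).re : ℝ) : ℂ) =
        ∑ k ∈ S, WithLp.ofLp (Torus.convectionCoeff S c (tcoef (g i)) (-k)) ⬝ᵥ WithLp.ofLp (c k) :=
      fun i => bracketSum_eq' hS (hc.convectionCoeff hS (hGcs i)) hc
    have hcast : (((∑ i, MvPolynomial.eval (fun j => ∑ k ∈ S', (inner ℂ (c k) (tcoef (g j) k)).re)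
        (MvPolynomial.pderiv i P) * ∑ k ∈ S, (inner ℂ (Torus.convectionCoeff S c (tcoef (g i)) k) (c k)).re : ℝ)) : ℂ) =
        ∑ i, ∑ j, (((MvPolynomial.pderiv j (MvPolynomial.pderiv i P)).coeff 0 : ℝ) : ℂ) *
          (∑ k ∈ S', WithLp.ofLp (c k) ⬝ᵥ WithLp.ofLp (tcoef (g j) (-k))) *
          (∑ k ∈ S, WithLp.ofLp (Torus.convectionCoeff S c (tcoef (g i)) (-k)) ⬝ᵥ WithLp.ofLp (c k)) := by
      rw [Complex.ofReal_sum]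
      refine Finset.sum_congr rfl fun i _ => ?_
      rw [Complex.ofReal_mul, eval_pderiv_of_isHomogeneous_two hP, Complex.ofReal_sum, Complex.ofReal_sum, e2 i,
        Finset.sum_mul]
      refine Finset.sum_congr rfl fun j _ => ?_
      rw [Complex.ofReal_mul, Complex.ofReal_sum, e1 j]
    rw [← hcast, hF c hc hT hsupp, Complex.ofReal_zero]
  -- Step B: polarisation and complexification on the one-sided probes
  have key := trilinear_symm_sum_eq_zero
    (fun x y z => (∑ i, ∑ j, (fun i j => (((MvPolynomial.pderiv j (MvPolynomial.pderiv i P)).coeff 0 : ℝ) : ℂ)) i j * (∑ k ∈ S', WithLp.ofLp ((y) k) ⬝ᵥ WithLp.ofLp ((fun i => tcoef (g i)) j (-k))) * (∑ k ∈ S, WithLp.ofLp (Torus.convectionCoeff S (x) ((fun i => tcoef (g i)) i) (-k)) ⬝ᵥ WithLp.ofLp ((z) k))))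
    (gamma_add₁ S S' _ _) (gamma_add₂ S S' _ _) (gamma_add₃ S S' _ _)
    (gamma_smul₁ S S' _ _) (gamma_smul₂ S S' _ _) (gamma_smul₃ S S' _ _) _ hA hΓ
    (probe_decomposition hk₁' hv₁) (probe_decomposition hk₂' hv₂) (probe_decomposition hk₃' hv₃)
  -- Step C: evaluate the six terms
  have g123 := gamma_single S S' (fun i => tcoef (g i))
    (fun i j => (((MvPolynomial.pderiv j (MvPolynomial.pderiv i P)).coeff 0 : ℝ) : ℂ))
    hSS hGsupp (hSS hk₁') hk₂' (hSS hk₃') v₁ v₂ v₃ hv₁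
  have g132 := gamma_single S S' (fun i => tcoef (g i))
    (fun i j => (((MvPolynomial.pderiv j (MvPolynomial.pderiv i P)).coeff 0 : ℝ) : ℂ))
    hSS hGsupp (hSS hk₁') hk₃' (hSS hk₂') v₁ v₃ v₂ hv₁
  have g213 := gamma_single S S' (fun i => tcoef (g i))
    (fun i j => (((MvPolynomial.pderiv j (MvPolynomial.pderiv i P)).coeff 0 : ℝ) : ℂ))
    hSS hGsupp (hSS hk₂') hk₁' (hSS hk₃') v₂ v₁ v₃ hv₂
  have g231 := gamma_single S S' (fun i => tcoef (g i))
    (fun i j => (((MvPolynomial.pderiv j (MvPolynomial.pderiv i P)).coeff 0 : ℝ) : ℂ))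
    hSS hGsupp (hSS hk₂') hk₃' (hSS hk₁') v₂ v₃ v₁ hv₂
  have g312 := gamma_single S S' (fun i => tcoef (g i))
    (fun i j => (((MvPolynomial.pderiv j (MvPolynomial.pderiv i P)).coeff 0 : ℝ) : ℂ))
    hSS hGsupp (hSS hk₃') hk₁' (hSS hk₂') v₃ v₁ v₂ hv₃
  have g321 := gamma_single S S' (fun i => tcoef (g i))
    (fun i j => (((MvPolynomial.pderiv j (MvPolynomial.pderiv i P)).coeff 0 : ℝ) : ℂ))
    hSS hGsupp (hSS hk₃') hk₂' (hSS hk₁') v₃ v₂ v₁ hv₃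
  beta_reduce at key
  rw [g123, g132, g213, g231, g312, g321] at key
  rw [add_comm k₂ k₁, add_comm k₃ k₁, add_comm k₃ k₂] at key
  have h2pi : (2 * Real.pi * Complex.I : ℂ) ≠ 0 := by simp [Real.pi_ne_zero, Complex.I_ne_zero]
  rw [← mul_right_inj' h2pi, mul_zero]
  simp only [add_dotProduct, smul_dotProduct, smul_eq_mul]
  linear_combination (-1 : ℂ) * key

end Main

end

end Summit.AnomalousDissipation.AnomalousDissipation.Theorems.MomentParityQuarticGate.AxialQuad

namespace Summit.AnomalousDissipation.AnomalousDissipation.Theorems.MomentParityQuarticGate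

open Literature.Analysis.FunctionSpaces Literature.Analysis.FluidPDE
open Summit.AnomalousDissipation.AnomalousDissipation.Theorems.QuarticGate.Negative

-- the summit-side namespace repeats `AnomalousDissipation` by the tree's convention
set_option linter.dupNamespace false in
/-- **Registered sub-goal `axialQuad_pol` of stub S2q** (summary of this file): the Hessian blocks of a homogeneous quadratic Casimir satisfy the polarised single-triad identity `(POL)`. [folklore] -/
theorem axialQuad_pol : ∀ (N m : ℕ) (g : Fin m → UnitAddTorus (Fin 3) → EuclideanSpace ℝ (Fin 3)), (∀ i, IsBandTest N (g i)) → ∀ (P : MvPolynomial (Fin m) ℝ), P.IsHomogeneous 2 → (∀ u : Torus.energySpace (Fin 3), IsLevel N u → Torus.nsGeneratorPairing (d := Fin 3) 0 0 u (polyGrad g P u) = 0) → ∀ (k₁ k₂ k₃ : Fin 3 → ℤ) (v₁ v₂ v₃ : Fin 3 → ℂ), ((k₁ : Fin 3 → ℤ) ≠ 0 ∧ (k₁) ⬝ᵥ (k₁) ≤ ((N : ℕ) : ℤ) ^ 2) → ((k₂ : Fin 3 → ℤ) ≠ 0 ∧ (k₂) ⬝ᵥ (k₂) ≤ ((N : ℕ)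 : ℤ) ^ 2) → ((k₃ : Fin 3 → ℤ) ≠ 0 ∧ (k₃) ⬝ᵥ (k₃) ≤ ((N : ℕ) : ℤ) ^ 2) → v₁ ⬝ᵥ (fun i : Fin 3 => (((k₁ : Fin 3 → ℤ) i : ℤ) : ℂ)) = 0 → v₂ ⬝ᵥ (fun i : Fin 3 => (((k₂ : Fin 3 → ℤ) i : ℤ) : ℂ)) = 0 → v₃ ⬝ᵥ (fun i : Fin 3 => (((k₃ : Fin 3 → ℤ) i : ℤ) : ℂ)) = 0 → (((v₁) ⬝ᵥ (fun i : Fin 3 => (((k₂ : Fin 3 → ℤ) i : ℤ) : ℂ))) • (v₂) + ((v₂) ⬝ᵥ (fun i : Fin 3 => (((k₁ : Fin 3 → ℤ) i : ℤ) : ℂ))) • (v₁) : Fin 3 → ℂ) ⬝ᵥ (Matrix.mulVec (∑ i, ∑ j, (((MvPolynomial.pderiv j (MvPolynomial.pderiv i P)).coeff 0 : ℝ) : ℂ) • Matrix.vecMulVec (WithLp.ofLp (tcoef (g i) (-(k₁ + k₂)))) (WithLp.ofLp (tcoef (g j) (-(k₃))))) v₃) + (((v₁) ⬝ᵥ (fun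 i : Fin 3 => (((k₃ : Fin 3 → ℤ) i : ℤ) : ℂ))) • (v₃) + ((v₃) ⬝ᵥ (fun i : Fin 3 => (((k₁ : Fin 3 → ℤ) i : ℤ) : ℂ))) • (v₁) : Fin 3 → ℂ) ⬝ᵥ (Matrix.mulVec (∑ i, ∑ j, (((MvPolynomial.pderiv j (MvPolynomial.pderiv i P)).coeff 0 : ℝ) : ℂ) • Matrix.vecMulVec (WithLp.ofLp (tcoef (g i) (-(k₁ + k₃)))) (WithLp.ofLp (tcoef (g j) (-(k₂))))) v₂) + (((v₂) ⬝ᵥ (fun i : Fin 3 => (((k₃ : Fin 3 → ℤ) i : ℤ) : ℂ))) • (v₃) + ((v₃) ⬝ᵥ (fun i : Fin 3 => (((k₂ : Fin 3 → ℤ) i : ℤ) : ℂ))) • (v₂) : Fin 3 → ℂ) ⬝ᵥ (Matrix.mulVec (∑ i, ∑ j, (((MvPolynomial.pderiv j (MvPolynomial.pderiv i P)).coeff 0 : ℝ) : ℂ) • Matrix.vecMulVec (WithLp.ofLp (tcoef (g i) (-(k₂ + k₃)))) (WithLp.ofLp (tcoef (g j) (-(k₁))))) v₁) = 0 :=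
  fun _ _ g hg P hP hCas k₁ k₂ k₃ v₁ v₂ v₃ hk₁ hk₂ hk₃ hv₁ hv₂ hv₃ => AxialQuad.pol_of_casimir g hg P hP hCas k₁ k₂ k₃ v₁ v₂ v₃ hk₁ hk₂ hk₃ hv₁ hv₂ hv₃

end Summit.AnomalousDissipation.AnomalousDissipation.Theorems.MomentParityQuarticGate
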